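/-
Copyright (c) 2026 the pub-hodgecm-mathlib formalisation cell (harness21).  Prover seat hodgecm-mathlib-K2E4-p14 (g5), Track B ∕ K2-LIT, h413 =
`stmt-HodgeConjecture-24833`, line `K2_E1_TraceFormulaBeta`, campaign «EIS-RANK-ONE» rung R6f(ii); ED. 5 of «EIS-R6-CM», dealt by K2E1-plan (g3) 2026-09-04T06:07:26Z
(«DISCHARGE `hMf`∕`hMf′` by DEFINING-IN-PROOF `φt g := (∫ v, f_z(W v g) ∂ν) · H(g)^{z−2}` … if boundedness needs more than ★ gives, keep it named and discharge the other three»).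
-/
import Summits.HodgeConjecture.HodgeConjecture.Theorems.K2E1MaassSelbergCMThreeConstantTerms  -- ★ p857809 (this seat): ED. 4 (`hCT`, `hCT′`, `hM′ψ` discharged)
import Summits.HodgeConjecture.HodgeConjecture.Theorems.K2E1IntertwinedSectionInvariance     -- ★ p857524 (K2E1-p09 g4): `∫ f(w₀ v u g) = ∫ f(w₀ v g)` (`u ∈ N(𝔸)`, `u ∈ B(F)`)
import HarnessLib

/-!
# K2·E1 — `K2E1MaassSelbergCMThreeIntertwined`: THE MAASS–SELBERG RELATION FOR FLAT SECTIONS OF `U(J₃)` WITH THE INTERTWINED COEFFICIENTS SPELLED OUT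
# (campaign «EIS-RANK-ONE», rung R6f(ii), ED. 5 of «EIS-R6-CM»: ★ ED. 4 `maassSelberg_flatSectionU_three_ct` with `φ̃ := (M f_z)·H^{z−2}`, `φ̃′` DEFINED and `hMf`, `hMf′` + three structural binders DISCHARGED)

Track B ∕ K2-LIT, crux h413 = `stmt-HodgeConjecture-24833`, route of record `HCCMUnconditional`; cell `hodgecm-mathlib`, squad K2, ENGINE E1.  Prover seat
`hodgecm-mathlib-K2E4-p14` (g5); dealt by K2E1-plan (g3) 2026-09-04T06:07:26Z (census + REPORT-FIRST 06:1xZ).  THEOREMS ONLY (no `def`, no `instance`, no notation, no named-fact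
hypothesis, no `sorry`); lane `--supports stmt-HodgeConjecture-24833 --as helper` (count-neutral).  Closes no socket.

THE MATHEMATICS [MoeglinWaldspurger1995, II.1.6–II.1.7, IV.2.1–IV.2.3; Garrett2018, §2.8, §11.3; Rogawski1990, §2.2].  In ★ ED. 4 the intertwined sections entered as ABSTRACT flat sections
`f̃ = φ̃·H^{2−z}`, `f̃′ = φ̃′·H^{2−z′}` tied to `f_z`, `f′_{z′}` by the named identities `hMf : ∫_{N(𝔸)} f_z(w₀ v g) dν = f̃(g)`, `hMf′`.  Here the coefficients are DEFINED:
  **`φ̃(g) := (∫_{N(𝔸)} f_z(w₀ v g) dν(v)) · H(g)^{z−2}`**, `φ̃′` likewise,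
so that `φ̃·H^{2−z} = M(w₀) f_z` IDENTICALLY (`H > 0`, `H^{z−2}·H^{2−z} = 1`: `hMf`, `hMf′` hold by `cpow_add`), and three of their four structural binders are PROVED for every Borel,
bounded, left-`N(𝔸)`- and left-`B(F)`-invariant `φ`: (i) `φ̃` is left-`N(𝔸)`-invariant — ★ p857524 `integral_weyl_mul_unipotent_mul_three` (`N(𝔸)` unimodular) and `H(u g) = H(g)`;
(ii) `φ̃` is left-`B(F)`-invariant — ★ p857524 `integral_weyl_mul_toAdelic_borelU_mul_three` (Levi decomposition of `b₀ ∈ B(F)`, `w₀ T(F) w₀⁻¹ ⊆ T(F)`, the product formula «conjugation by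
`B(F)` preserves `ν`» ★ p857500) and `H(b g) = H(g)`; (iii) `φ̃` is Borel — the parametric Bochner integral of the jointly Borel `(v, g) ↦ f_z(w₀ v g)` (Mathlib
`StronglyMeasurable.integral_prod_left′`; `G(𝔸)`, `N(𝔸)` second countable, `ν` s-finite as a Haar measure on the closed subgroup `N(𝔸)`), times the Borel `H^{z−2}`.
The fourth binder, BOUNDEDNESS `‖φ̃‖ ≤ C_φ̃` — i.e. the flat growth `|M(w₀) f_z| ≤ C·H^{2−Re z}`, the standard intertwining integral `∫_{N(𝔸)} H(w₀ v g)^σ dν = c(σ)·H(g)^{2−σ}`, `c(σ) < ∞` for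
`σ > 2` (Gindikin–Karpelevich ∕ Godement; ★ R5a p857354 holds the torus equivariance and the absolute convergence in the right-action convention) — stays NAMED (`hφ̃C`, `hφ̃′C`), as ruled.
§2 **`maassSelberg_flatSectionU_three_int`** = ★ ED. 4 with the binder block `∀ {φ φ′}` only: `φ̃`, `φ̃′` are the displayed terms wherever ED. 4 had `φt`, `φt′` (in `ψ`, `χ`, `hψL1`, `hi₅`,
`habs`∕`habs′` and in the `K_U`-average hypotheses `hΞ₂ hΞ₃ hΞ₄`), the binders `hφtm hφtN hφtB hMf` (×2) are GONE, `hφ̃C`∕`hφ̃′C` kept; conclusion verbatim.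
NAMED INPUTS KEPT (supplier): `hφ̃C`∕`hφ̃′C` (R5 growth of `M(w₀) f_z`), `hfinz`∕`hfinz′`∕`hint′`∕`hsum` (★ at CM), `Λ′ = Λ^T E(f′_{z′})` Borel∕invariant∕bounded (★ p857707 ∘ `hdec`), `hψL1`,
`hi₅`, `habs`∕`habs′`, coefficient facts for `φ, φ′`, `hΞᵢ`.
HONEST LABEL: HC_CM is proved only modulo the 7 printed citations (2 remaining named inputs: hLiu418 = `stmt-HodgeConjecture-24832`, h413 = `stmt-HodgeConjecture-24833`) until rung 0
closes; this file asserts no named fact and closes no socket.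
References: [MoeglinWaldspurger1995] II.1.6–II.1.7, IV.2.1–IV.2.3 · [Garrett2018] §2.8, §11.3 · [Rogawski1990] §2.2 · [Arthur1980TraceFormulaII] §4.
-/

set_option autoImplicit false
-- the mandated namespace repeats the single-problem summit's segment (`HodgeConjecture.HodgeConjecture`)
set_option linter.dupNamespace false

noncomputable section

open MeasureTheory Measure NumberField IsDedekindDomain Set MulAction Filter Matrix
open scoped ENNReal NNReal ComplexConjugate MatrixGroups
open Literature.MeasureTheory.Group Literature.NumberTheory
open Literature.NumberTheory.Automorphic Literature.NumberTheory.Automorphic.UnitaryGroup AdelicGroupData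
open Summit.HodgeConjecture.HodgeConjecture.Cruxes.H413.K2E1BorelEisensteinU
open Summit.HodgeConjecture.HodgeConjecture.Cruxes.H413.K2E1MaassSelbergBracketsThree
open Summit.HodgeConjecture.HodgeConjecture.Cruxes.H413.K2E1MaassSelbergCMThreeConstantTerms
open Summit.HodgeConjecture.HodgeConjecture.Cruxes.H413.K2E1IntertwinedSectionInvariance
open Summit.HodgeConjecture.HodgeConjecture.Cruxes.H413.K2E1BorelCosetsDictionary (forall_arithmeticBorel_iff mem_arithmeticBorel_iff_of_toAdelic_eq)

namespace Summit.HodgeConjecture.HodgeConjecture.Cruxes.H413.K2E1MaassSelbergCMThreeIntertwined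

variable {F E : Type} [Field F] [NumberField F] [Field E] [NumberField E] [Algebra F E] {c : E ≃ₐ[F] E}
variable [MeasurableSpace (quasiSplit F E c 3).Adelic] [BorelSpace (quasiSplit F E c 3).Adelic]

/-! ## §1 The intertwined coefficient `φ̃_{a,b}(g) := (∫_{N(𝔸)} f_a(w₀ v g) dν)·H(g)^b` of a flat section: Borel, `N(𝔸)`-invariant, `B(F)`-invariant; `φ̃_{a,a−2}·H^{2−a} = M(w₀) f_a` -/

/-- **`φ̃` IS BOREL** for Borel `α` (`ν` a Haar measure on `N(𝔸_F)`): the parametric Bochner integral `g ↦ ∫ f_a(w₀ v g) dν(v)` of the jointly Borel integrand (Mathlib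
`StronglyMeasurable.integral_prod_left′`; `G(𝔸)`, `N(𝔸)` second countable, `ν` s-finite — Haar on the closed subgroup `N(𝔸)` of the locally compact `G(𝔸)`), times `H^b`.
[cite: MoeglinWaldspurger1995, II.1.6] -/
theorem measurable_intertwinedCoeff (ν : Measure ↥(adelicUnipotent F E c 3)) [ν.IsHaarMeasure] {α : (quasiSplit F E c 3).Adelic → ℂ} (hα : Measurable α) (a b : ℂ) :
    Measurable (fun g : (quasiSplit F E c 3).Adelic => (∫ v : ↥(adelicUnipotent F E c 3), flatSectionU α a ((quasiSplit F E c 3).toAdelic (weylLongU (c : E →+* E) (rfl : (StdForm.antidiagonal 3).over E = (StdForm.antidiagonal 3).over E)) * ((v : (quasiSplit F E c 3).Adelic) * g)) ∂ν) * ((borelHeight g : ℝ) : ℂ) ^ b) := by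
  haveI := secondCountableTopology_adeleRing E
  haveI := locallyCompactSpace_adeleRing' E
  haveI := t2Space_adeleRing_of_numberField E
  haveI : SecondCountableTopology (quasiSplit F E c 3).Adelic := inferInstanceAs (SecondCountableTopology (adelic F E c 3 ((StdForm.antidiagonal 3).over E)))
  haveI : LocallyCompactSpace (quasiSplit F E c 3).Adelic := inferInstanceAs (LocallyCompactSpace (adelic F E c 3 ((StdForm.antidiagonal 3).over E)))
  haveI : SecondCountableTopology ↥(adelicUnipotent F E c 3) := TopologicalSpace.Subtype.secondCountableTopology _
  have hNcl : IsClosed ((adelicUnipotent F E c 3 : Subgroup (quasiSplit F E c 3).Adelic) : Set (quasiSplit F E c 3).Adelic) := by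
    change IsClosed (⇑(adelicVal F E c 3 ((StdForm.antidiagonal 3).over E)) ⁻¹'
      ((upperUnitriangular (Fin 3) (AdeleRing (𝓞 E) E) : Subgroup (GL (Fin 3) (AdeleRing (𝓞 E) E))) : Set (GL (Fin 3) (AdeleRing (𝓞 E) E))))
    exact (isClosed_upperUnitriangular (R := AdeleRing (𝓞 E) E)).preimage continuous_subtype_val
  haveI : LocallyCompactSpace ↥(adelicUnipotent F E c 3) := hNcl.locallyCompactSpace
  have hF : Measurable fun q : ↥(adelicUnipotent F E c 3) × (quasiSplit F E c 3).Adelic => flatSectionU α a ((quasiSplit F E c 3).toAdelic (weylLongU (c : E →+* E) (rfl : (StdForm.antidiagonal 3).over E = (StdForm.antidiagonal 3).over E)) * ((q.1 : (quasiSplit F E c 3).Adelic) * q.2)) :=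
    (measurable_flatSectionU hα a).comp (continuous_const.mul ((continuous_subtype_val.comp continuous_fst).mul continuous_snd)).measurable
  exact (MeasureTheory.StronglyMeasurable.integral_prod_left' (μ := ν) hF.stronglyMeasurable).measurable.mul
    ((Complex.measurable_ofReal.comp measurable_borelHeight.coe_nnreal_real).pow_const _)

/-- **`φ̃` IS LEFT-`N(𝔸_F)`-INVARIANT** (whatever `α`): `N(𝔸)` is unimodular, so `∫ f(w₀ v (u g)) dν = ∫ f(w₀ v g) dν` (★ p857524), and `H(u g) = H(g)`. [cite: MoeglinWaldspurger1995, II.1.6] -/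
theorem intertwinedCoeff_unipotent_mul (hc : c * c = 1) (ν : Measure ↥(adelicUnipotent F E c 3)) [ν.IsHaarMeasure] (α : (quasiSplit F E c 3).Adelic → ℂ) (a b : ℂ) :
    ∀ (n : unipotentInBorel F E c 3) (y : (quasiSplit F E c 3).Adelic), (fun g : (quasiSplit F E c 3).Adelic => (∫ v : ↥(adelicUnipotent F E c 3), flatSectionU α a ((quasiSplit F E c 3).toAdelic (weylLongU (c : E →+* E) (rfl : (StdForm.antidiagonal 3).over E = (StdForm.antidiagonal 3).over E)) * ((v : (quasiSplit F E c 3).Adelic) * g)) ∂ν) * ((borelHeight g : ℝ) : ℂ) ^ b) (((n : borelAdelic F E c 3) : (quasiSplit F E c 3).Adelic) * y) = (fun g : (quasiSplit F E c 3).Adelic => (∫ v : ↥(adelicUnipotent F E c 3), flatSectionU α a ((quasiSplit F E c 3).toAdelic (weylLongU (c : E →+* E) (rfl : (StdForm.antidiagonal 3).over E = (StdForm.antidiagonal 3).over E)) * ((v : (quasiSplit F E c 3).Adelic) * g)) ∂ν) * ((borelHeight g : ℝ) : ℂ) ^ b) y := by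
  intro n y
  have hn : ((n : borelAdelic F E c 3) : (quasiSplit F E c 3).Adelic) ∈ adelicUnipotent F E c 3 := (mem_unipotentInBorel_iff _).1 n.2
  have key := integral_weyl_mul_unipotent_mul_three hc ν (flatSectionU α a) hn y
  simp_rw [mul_assoc] at key
  dsimp only
  rw [borelHeight_unipotent_mul hn y, key]

/-- **`φ̃` IS LEFT-`B(F)`-INVARIANT** for Borel left-`B(F)`-invariant `α` (`c² = 1`, `c ≠ 1`): ★ p857524 `integral_weyl_mul_toAdelic_borelU_mul_three` (Levi decomposition, `w₀ T(F) w₀⁻¹ ⊆ T(F)`,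
conjugation by `B(F)` preserves `ν`) and `H(b g) = H(g)`. [cite: MoeglinWaldspurger1995, II.1.7] [cite: Garrett2018, §2.8] -/
theorem intertwinedCoeff_arithmeticBorel_mul (hc : c * c = 1) (hc1 : c ≠ 1) (ν : Measure ↥(adelicUnipotent F E c 3)) [ν.IsHaarMeasure] {α : (quasiSplit F E c 3).Adelic → ℂ} (hα : Measurable α)
    (hαB : ∀ b ∈ arithmeticBorel F E c 3, ∀ y : (quasiSplit F E c 3).Adelic, α ((b : (quasiSplit F E c 3).Adelic) * y) = α y) (a b : ℂ) :
    ∀ β₀ ∈ arithmeticBorel F E c 3, ∀ y : (quasiSplit F E c 3).Adelic, (fun g : (quasiSplit F E c 3).Adelic => (∫ v : ↥(adelicUnipotent F E c 3), flatSectionU α a ((quasiSplit F E c 3).toAdelic (weylLongU (c : E →+* E) (rfl : (StdForm.antidiagonal 3).over E = (StdForm.antidiagonal 3).over E)) * ((v : (quasiSplit F E c 3).Adelic) * g)) ∂ν) * ((borelHeight g : ℝ) : ℂ) ^ b) ((β₀ : (quasiSplit F E c 3).Adelic) * y) = (fun g : (quasiSplit F E c 3).Adelic => (∫ v : ↥(adelicUnipotent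 F E c 3), flatSectionU α a ((quasiSplit F E c 3).toAdelic (weylLongU (c : E →+* E) (rfl : (StdForm.antidiagonal 3).over E = (StdForm.antidiagonal 3).over E)) * ((v : (quasiSplit F E c 3).Adelic) * g)) ∂ν) * ((borelHeight g : ℝ) : ℂ) ^ b) y := by
  intro β₀ hβ₀ y
  have hfB : ∀ b ∈ arithmeticBorel F E c 3, ∀ x : (quasiSplit F E c 3).Adelic, flatSectionU α a ((b : (quasiSplit F E c 3).Adelic) * x) = flatSectionU α a x := fun b hb x => by
    rw [flatSectionU_apply, flatSectionU_apply, hαB b hb x, borelHeight_arithmeticBorel_mul hb]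
  obtain ⟨b₀, hb₀⟩ := MonoidHom.mem_range.1 β₀.2
  have hb₀B := (mem_arithmeticBorel_iff_of_toAdelic_eq hb₀).1 hβ₀
  have key := integral_weyl_mul_toAdelic_borelU_mul_three hc hc1 ν (measurable_flatSectionU hα a) (forall_arithmeticBorel_iff.1 hfB) hb₀B y
  simp_rw [mul_assoc] at key
  dsimp only
  rw [borelHeight_arithmeticBorel_mul hβ₀ y, ← hb₀, key]

omit [BorelSpace (quasiSplit F E c 3).Adelic] in
/-- **`φ̃·H^{2−a} = M(w₀) f_a`** for `φ̃ = (M(w₀) f_a)·H^{a−2}`: `H > 0`, `H^{a−2}·H^{2−a} = H^0 = 1` — the named identity `hMf` of ★ ED. 4 holds by definition. [cite: MoeglinWaldspurger1995, II.1.6] -/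
theorem flatSectionU_intertwinedCoeff (ν : Measure ↥(adelicUnipotent F E c 3)) (α : (quasiSplit F E c 3).Adelic → ℂ) (a : ℂ) (g : (quasiSplit F E c 3).Adelic) :
    flatSectionU (fun g : (quasiSplit F E c 3).Adelic => (∫ v : ↥(adelicUnipotent F E c 3), flatSectionU α a ((quasiSplit F E c 3).toAdelic (weylLongU (c : E →+* E) (rfl : (StdForm.antidiagonal 3).over E = (StdForm.antidiagonal 3).over E)) * ((v : (quasiSplit F E c 3).Adelic) * g)) ∂ν) * ((borelHeight g : ℝ) : ℂ) ^ (a - 2)) (2 - a) g = ∫ v : ↥(adelicUnipotent F E c 3), flatSectionU α a ((quasiSplit F E c 3).toAdelic (weylLongU (c : E →+* E) (rfl : (StdForm.antidiagonal 3).over E = (StdForm.antidiagonal 3).over E)) * ((v : (quasiSplit F E c 3).Adelic) * g)) ∂ν := by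
  have hne : ((borelHeight g : ℝ) : ℂ) ≠ 0 := Complex.ofReal_ne_zero.2 (ne_of_gt (by exact_mod_cast borelHeight_pos g))
  rw [flatSectionU_apply, mul_assoc, ← Complex.cpow_add _ _ hne, show a - 2 + (2 - a) = 0 by ring, Complex.cpow_zero, mul_one]

/-! ## §2 ED. 5: `φ̃`, `φ̃′` spelled out; `hMf`, `hMf′` and three structural binders each discharged -/

section Intertwined

variable [MeasurableSpace (AdeleRing (𝓞 E) E)ˣ] [BorelSpace (AdeleRing (𝓞 E) E)ˣ]

/-- **THE MAASS–SELBERG RELATION FOR FLAT SECTIONS OF `U(J₃)` — INTERTWINED COEFFICIENTS DEFINED.**  ★ ED. 4 `maassSelberg_flatSectionU_three_ct` at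
`φ̃ := (M(w₀) f_z)·H^{z−2}`, `φ̃′ := (M(w₀) f′_{z′})·H^{z′−2}` (§1), so that only their boundedness `hφ̃C`, `hφ̃′C` (the flat growth of `M(w₀) f`, R5) remains named among the
coefficient facts; everything else as in ED. 4. [cite: MoeglinWaldspurger1995, II.1.6–II.1.7 and IV.2.1–IV.2.3] [cite: Garrett2018, §2.8 and §11.3] [cite: Arthur1980TraceFormulaII, §4] -/
theorem maassSelberg_flatSectionU_three_int (h2 : Module.finrank F E = 2) (hc : c * c = 1) (hc1 : c ≠ 1)
    (μ : Measure (quasiSplit F E c 3).automorphicQuotient) [(quasiSplit F E c 3).IsAutomorphicMeasure μ]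
    (νG : Measure (quasiSplit F E c 3).Adelic) [νG.IsHaarMeasure] [νG.IsInvInvariant]
    (μK : Measure ((standardMaximalCompactGL 3 E).comap (adelicVal F E c 3 ((StdForm.antidiagonal 3).over E)) : Subgroup (quasiSplit F E c 3).Adelic))
    [μK.IsHaarMeasure]
    (νI : Measure (AdeleRing (𝓞 E) E)ˣ) [νI.IsHaarMeasure]
    (hBK : ∀ g : (quasiSplit F E c 3).Adelic, ∃ b ∈ borelAdelic F E c 3, ∃ k : (quasiSplit F E c 3).Adelic,
      adelicVal F E c 3 ((StdForm.antidiagonal 3).over E) k ∈ standardMaximalCompactGL 3 E ∧ g = b * k)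
    {𝓕I : Set (AdeleRing (𝓞 E) E)ˣ} (h𝓕I : IsIdeleClassDomain E 𝓕I)
    (ν : Measure ↥(adelicUnipotent F E c 3)) [ν.IsHaarMeasure] [ν.IsInvInvariant]
    {𝓕 : Set ↥(adelicUnipotent F E c 3)} (h𝓕N : IsFundamentalDomain ↥(rationalUnipotent F E c 3) 𝓕 ν) (h𝓕1 : ν 𝓕 = 1) :
    ∃ cμ K : ℝ, 0 < cμ ∧ 0 < K ∧
      ∀ {β : (quasiSplit F E c 3).Adelic → ℝ≥0∞}, IsCoveringWeight ((arithmeticBorel F E c 3).map (quasiSplit F E c 3).arithmeticSubgroup.subtype) β →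
      ∀ {T : ℝ≥0}, 1 ≤ T →
      ∀ {φ φ' : (quasiSplit F E c 3).Adelic → ℂ},
      Measurable φ →
        (∀ (n : unipotentInBorel F E c 3) (y : (quasiSplit F E c 3).Adelic), φ (((n : borelAdelic F E c 3) : (quasiSplit F E c 3).Adelic) * y) = φ y) →
        (∀ b ∈ arithmeticBorel F E c 3, ∀ y : (quasiSplit F E c 3).Adelic, φ ((b : (quasiSplit F E c 3).Adelic) * y) = φ y) →
      ∀ {Cφ : ℝ}, (∀ x, ‖φ x‖ ≤ Cφ) →
      Measurable φ' →
        (∀ (n : unipotentInBorel F E c 3) (y : (quasiSplit F E c 3).Adelic), φ' (((n : borelAdelic F E c 3) : (quasiSplit F E c 3).Adelic) * y) = φ' y) →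
        (∀ b ∈ arithmeticBorel F E c 3, ∀ y : (quasiSplit F E c 3).Adelic, φ' ((b : (quasiSplit F E c 3).Adelic) * y) = φ' y) →
      ∀ {Cφ' : ℝ}, (∀ x, ‖φ' x‖ ≤ Cφ') →
      ∀ {z z' : ℂ}, 2 < z'.re → z'.re < z.re →
      -- NAMED: the flat growth of the INTERTWINED coefficients `φ̃ = (M f_z)·H^{z−2}`, `φ̃′` (R5: the standard intertwining integral `c(σ)·H^{2−σ}`), and the Godement finiteness of `H^z`, `H^{z′}`
        ∀ {Cφt : ℝ}, (∀ x, ‖(fun g : (quasiSplit F E c 3).Adelic => (∫ v : ↥(adelicUnipotent F E c 3), flatSectionU φ z ((quasiSplit F E c 3).toAdelic (weylLongU (c : E →+* E) (rfl : (StdForm.antidiagonal 3).over E = (StdForm.antidiagonal 3).over E)) * ((v : (quasiSplit F E c 3).Adelic) * g)) ∂ν) * ((borelHeight g : ℝ) : ℂ) ^ (z - 2)) x‖ ≤ Cφt) →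
        ∀ {Cφt' : ℝ}, (∀ x, ‖(fun g : (quasiSplit F E c 3).Adelic => (∫ v : ↥(adelicUnipotent F E c 3), flatSectionU φ' z' ((quasiSplit F E c 3).toAdelic (weylLongU (c : E →+* E) (rfl : (StdForm.antidiagonal 3).over E = (StdForm.antidiagonal 3).over E)) * ((v : (quasiSplit F E c 3).Adelic) * g)) ∂ν) * ((borelHeight g : ℝ) : ℂ) ^ (z' - 2)) x‖ ≤ Cφt') →
        (∀ g : (quasiSplit F E c 3).Adelic, ∫⁻ u in 𝓕, (∑' q : (quasiSplit F E c 3).quotientSubgroup ⧸ (borelAdelic F E c 3).subgroupOf (quasiSplit F E c 3).quotientSubgroup,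
            ‖flatSectionU (fun _ : (quasiSplit F E c 3).Adelic => (1 : ℂ)) z ((((q.out : (quasiSplit F E c 3).quotientSubgroup) : (quasiSplit F E c 3).Adelic))⁻¹ * (u : (quasiSplit F E c 3).Adelic) * g)‖ₑ) ∂ν < ∞) →
        (∀ g : (quasiSplit F E c 3).Adelic, ∫⁻ u in 𝓕, (∑' q : (quasiSplit F E c 3).quotientSubgroup ⧸ (borelAdelic F E c 3).subgroupOf (quasiSplit F E c 3).quotientSubgroup,
            ‖flatSectionU (fun _ : (quasiSplit F E c 3).Adelic => (1 : ℂ)) z' ((((q.out : (quasiSplit F E c 3).quotientSubgroup) : (quasiSplit F E c 3).Adelic))⁻¹ * (u : (quasiSplit F E c 3).Adelic) * g)‖ₑ) ∂ν < ∞) →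
        (∀ g : (quasiSplit F E c 3).Adelic,
          Summable fun q : Quotient (orbitRel ↥(borelU (c : E →+* E) ((StdForm.antidiagonal 3).over E)) ↥(unitaryGroupOfForm (c : E →+* E) ((StdForm.antidiagonal 3).over E))) =>
            flatSectionU φ z ((quasiSplit F E c 3).toAdelic (q.out : ↥(unitaryGroupOfForm (c : E →+* E) ((StdForm.antidiagonal 3).over E))) * g)) →
      -- the truncated second series `Λ′ := Λ^T E(f′_{z′})`: Borel, `G(F)`-invariant, bounded (★ R6e ∕ p857707 at CM), and its Eisenstein series integrable along `N(F)∖N(𝔸)·g` (R4a)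
        Measurable (truncation ν 𝓕 T (eisensteinSeriesU (flatSectionU φ' z'))) →
        (∀ (γ : (quasiSplit F E c 3).arithmeticSubgroup) (x : (quasiSplit F E c 3).Adelic), truncation ν 𝓕 T (eisensteinSeriesU (flatSectionU φ' z')) ((γ : (quasiSplit F E c 3).Adelic) * x) = truncation ν 𝓕 T (eisensteinSeriesU (flatSectionU φ' z')) x) →
        ∀ {M₁ : ℝ}, (∀ g, ‖truncation ν 𝓕 T (eisensteinSeriesU (flatSectionU φ' z')) g‖ ≤ M₁) →
        (∀ g : (quasiSplit F E c 3).Adelic, IntegrableOn (fun u : ↥(adelicUnipotent F E c 3) => eisensteinSeriesU (flatSectionU φ' z') ((u : (quasiSplit F E c 3).Adelic) * g)) 𝓕 ν) →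
        ∫⁻ g, β g * ‖({y : (quasiSplit F E c 3).Adelic | borelHeight y ≤ T}.indicator (flatSectionU φ z) g - {y : (quasiSplit F E c 3).Adelic | T < borelHeight y}.indicator (flatSectionU (fun g : (quasiSplit F E c 3).Adelic => (∫ v : ↥(adelicUnipotent F E c 3), flatSectionU φ z ((quasiSplit F E c 3).toAdelic (weylLongU (c : E →+* E) (rfl : (StdForm.antidiagonal 3).over E = (StdForm.antidiagonal 3).over E)) * ((v : (quasiSplit F E c 3).Adelic) * g)) ∂ν) * ((borelHeight g : ℝ) : ℂ) ^ (z - 2)) (2 - z)) g)‖ₑ ∂νG < ∞ →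
        Integrable (fun g => (β g).toReal • (({y : (quasiSplit F E c 3).Adelic | borelHeight y ≤ T}.indicator (flatSectionU φ z) g - {y : (quasiSplit F E c 3).Adelic | T < borelHeight y}.indicator (flatSectionU (fun g : (quasiSplit F E c 3).Adelic => (∫ v : ↥(adelicUnipotent F E c 3), flatSectionU φ z ((quasiSplit F E c 3).toAdelic (weylLongU (c : E →+* E) (rfl : (StdForm.antidiagonal 3).over E = (StdForm.antidiagonal 3).over E)) * ((v : (quasiSplit F E c 3).Adelic) * g)) ∂ν) * ((borelHeight g : ℝ) : ℂ) ^ (z - 2)) (2 - z)) g) * conj (∫ u : ↥(adelicUnipotent F E c 3), {y : (quasiSplit F E c 3).Adelic | T < borelHeight y}.indicator (flatSectionU φ' z' + flatSectionU (fun g : (quasiSplit F E c 3).Adelic => (∫ v : ↥(adelicUnipotent F E c 3), flatSectionU φ' z' ((quasiSplit F E c 3).toAdelic (weylLongU (c : E →+* E) (rfl : (StdForm.antidiagonal 3).over E = (StdForm.antidiagonal 3).over E)) * ((v : (quasiSplit F E c 3).Adelic) * g)) ∂ν) * ((borelHeight g : ℝ) : ℂ) ^ (z' - 2)) (2 - z'))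 ((quasiSplit F E c 3).toAdelic (weylLongU (c : E →+* E) (rfl : (StdForm.antidiagonal 3).over E = (StdForm.antidiagonal 3).over E)) * ((u : (quasiSplit F E c 3).Adelic) * g)) ∂ν))) νG →
      -- ★ p857605's absolute convergence (`h := χ`, `F := ψ`)
        ∫⁻ g, β g * ∫⁻ u : ↥(adelicUnipotent F E c 3), ‖{y : (quasiSplit F E c 3).Adelic | T < borelHeight y}.indicator (flatSectionU φ' z' + flatSectionU (fun g : (quasiSplit F E c 3).Adelic => (∫ v : ↥(adelicUnipotent F E c 3), flatSectionU φ' z' ((quasiSplit F E c 3).toAdelic (weylLongU (c : E →+* E) (rfl : (StdForm.antidiagonal 3).over E = (StdForm.antidiagonal 3).over E)) * ((v : (quasiSplit F E c 3).Adelic) * g)) ∂ν) * ((borelHeight g : ℝ) : ℂ) ^ (z' - 2)) (2 - z')) ((quasiSplit F E c 3).toAdelic (weylLongU (c : E →+* E) (rfl : (StdForm.antidiagonal 3).over E = (StdForm.antidiagonal 3).over E)) * ((u : (quasiSplit F E c 3).Adelic) * g)) * conj ({y : (quasiSplit F E c 3).Adelic | borelHeight y ≤ T}.indicator (flatSectionU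 φ z) g - {y : (quasiSplit F E c 3).Adelic | T < borelHeight y}.indicator (flatSectionU (fun g : (quasiSplit F E c 3).Adelic => (∫ v : ↥(adelicUnipotent F E c 3), flatSectionU φ z ((quasiSplit F E c 3).toAdelic (weylLongU (c : E →+* E) (rfl : (StdForm.antidiagonal 3).over E = (StdForm.antidiagonal 3).over E)) * ((v : (quasiSplit F E c 3).Adelic) * g)) ∂ν) * ((borelHeight g : ℝ) : ℂ) ^ (z - 2)) (2 - z)) g)‖ₑ ∂ν ∂νG < ∞ →
        ∫⁻ g, β g * ∫⁻ u : ↥(adelicUnipotent F E c 3), ‖{y : (quasiSplit F E c 3).Adelic | T < borelHeight y}.indicator (flatSectionU φ' z' + flatSectionU (fun g : (quasiSplit F E c 3).Adelic => (∫ v : ↥(adelicUnipotent F E c 3), flatSectionU φ' z' ((quasiSplit F E c 3).toAdelic (weylLongU (c : E →+* E) (rfl : (StdForm.antidiagonal 3).over E = (StdForm.antidiagonal 3).over E)) * ((v : (quasiSplit F E c 3).Adelic) * g)) ∂ν) * ((borelHeight g : ℝ) : ℂ) ^ (z' - 2)) (2 - z')) g * conj ({y : (quasiSplit F E c 3).Adelic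 | borelHeight y ≤ T}.indicator (flatSectionU φ z) (((quasiSplit F E c 3).toAdelic (weylLongU (c : E →+* E) (rfl : (StdForm.antidiagonal 3).over E = (StdForm.antidiagonal 3).over E)))⁻¹ * ((u : (quasiSplit F E c 3).Adelic) * g)) - {y : (quasiSplit F E c 3).Adelic | T < borelHeight y}.indicator (flatSectionU (fun g : (quasiSplit F E c 3).Adelic => (∫ v : ↥(adelicUnipotent F E c 3), flatSectionU φ z ((quasiSplit F E c 3).toAdelic (weylLongU (c : E →+* E) (rfl : (StdForm.antidiagonal 3).over E = (StdForm.antidiagonal 3).over E)) * ((v : (quasiSplit F E c 3).Adelic) * g)) ∂ν) * ((borelHeight g : ℝ) : ℂ) ^ (z - 2)) (2 - z)) (((quasiSplit F E c 3).toAdelic (weylLongU (c : E →+* E) (rfl : (StdForm.antidiagonal 3).over E = (StdForm.antidiagonal 3).over E)))⁻¹ * ((u : (quasiSplit F E c 3).Adelic) * g)))‖ₑ ∂ν ∂νG < ∞ →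
      ∀ {Ξ₁ Ξ₂ Ξ₃ Ξ₄ : (AdeleRing (𝓞 E) E)ˣ → ℂ},
      Measurable Ξ₁ → ∀ {CΞ₁ : ℝ}, (∀ x, ‖Ξ₁ x‖ ≤ CΞ₁) → (∀ k ∈ GaloisRepresentations.principalIdeles E, ∀ x, Ξ₁ (k * x) = Ξ₁ x) →
        (∀ (r : ℝ≥0ˣ) (x : (AdeleRing (𝓞 E) E)ˣ), Ξ₁ (posRealIdele E r * x) = Ξ₁ x) →
        (∀ t : torusInBorel F E c 3,
          ∫ k, φ (((t : borelAdelic F E c 3) : (quasiSplit F E c 3).Adelic) * (k : (quasiSplit F E c 3).Adelic)) *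
              conj (φ' (((t : borelAdelic F E c 3) : (quasiSplit F E c 3).Adelic) * (k : (quasiSplit F E c 3).Adelic))) ∂μK = Ξ₁ (diagUnit (t : borelAdelic F E c 3).2 0)) →
      Measurable Ξ₂ → ∀ {CΞ₂ : ℝ}, (∀ x, ‖Ξ₂ x‖ ≤ CΞ₂) → (∀ k ∈ GaloisRepresentations.principalIdeles E, ∀ x, Ξ₂ (k * x) = Ξ₂ x) →
        (∀ (r : ℝ≥0ˣ) (x : (AdeleRing (𝓞 E) E)ˣ), Ξ₂ (posRealIdele E r * x) = Ξ₂ x) →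
        (∀ t : torusInBorel F E c 3,
          ∫ k, φ (((t : borelAdelic F E c 3) : (quasiSplit F E c 3).Adelic) * (k : (quasiSplit F E c 3).Adelic)) *
              conj ((fun g : (quasiSplit F E c 3).Adelic => (∫ v : ↥(adelicUnipotent F E c 3), flatSectionU φ' z' ((quasiSplit F E c 3).toAdelic (weylLongU (c : E →+* E) (rfl : (StdForm.antidiagonal 3).over E = (StdForm.antidiagonal 3).over E)) * ((v : (quasiSplit F E c 3).Adelic) * g)) ∂ν) * ((borelHeight g : ℝ) : ℂ) ^ (z' - 2)) (((t : borelAdelic F E c 3) : (quasiSplit F E c 3).Adelic) * (k : (quasiSplit F E c 3).Adelic))) ∂μK = Ξ₂ (diagUnit (t : borelAdelic F E c 3).2 0)) →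
      Measurable Ξ₃ → ∀ {CΞ₃ : ℝ}, (∀ x, ‖Ξ₃ x‖ ≤ CΞ₃) → (∀ k ∈ GaloisRepresentations.principalIdeles E, ∀ x, Ξ₃ (k * x) = Ξ₃ x) →
        (∀ (r : ℝ≥0ˣ) (x : (AdeleRing (𝓞 E) E)ˣ), Ξ₃ (posRealIdele E r * x) = Ξ₃ x) →
        (∀ t : torusInBorel F E c 3,
          ∫ k, (fun g : (quasiSplit F E c 3).Adelic => (∫ v : ↥(adelicUnipotent F E c 3), flatSectionU φ z ((quasiSplit F E c 3).toAdelic (weylLongU (c : E →+* E) (rfl : (StdForm.antidiagonal 3).over E = (StdForm.antidiagonal 3).over E)) * ((v : (quasiSplit F E c 3).Adelic) * g)) ∂ν) * ((borelHeight g : ℝ) : ℂ) ^ (z - 2)) (((t : borelAdelic F E c 3) : (quasiSplit F E c 3).Adelic) * (k : (quasiSplit F E c 3).Adelic)) *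
              conj (φ' (((t : borelAdelic F E c 3) : (quasiSplit F E c 3).Adelic) * (k : (quasiSplit F E c 3).Adelic))) ∂μK = Ξ₃ (diagUnit (t : borelAdelic F E c 3).2 0)) →
      Measurable Ξ₄ → ∀ {CΞ₄ : ℝ}, (∀ x, ‖Ξ₄ x‖ ≤ CΞ₄) → (∀ k ∈ GaloisRepresentations.principalIdeles E, ∀ x, Ξ₄ (k * x) = Ξ₄ x) →
        (∀ (r : ℝ≥0ˣ) (x : (AdeleRing (𝓞 E) E)ˣ), Ξ₄ (posRealIdele E r * x) = Ξ₄ x) →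
        (∀ t : torusInBorel F E c 3,
          ∫ k, (fun g : (quasiSplit F E c 3).Adelic => (∫ v : ↥(adelicUnipotent F E c 3), flatSectionU φ z ((quasiSplit F E c 3).toAdelic (weylLongU (c : E →+* E) (rfl : (StdForm.antidiagonal 3).over E = (StdForm.antidiagonal 3).over E)) * ((v : (quasiSplit F E c 3).Adelic) * g)) ∂ν) * ((borelHeight g : ℝ) : ℂ) ^ (z - 2)) (((t : borelAdelic F E c 3) : (quasiSplit F E c 3).Adelic) * (k : (quasiSplit F E c 3).Adelic)) *
              conj ((fun g : (quasiSplit F E c 3).Adelic => (∫ v : ↥(adelicUnipotent F E c 3), flatSectionU φ' z' ((quasiSplit F E c 3).toAdelic (weylLongU (c : E →+* E) (rfl : (StdForm.antidiagonal 3).over E = (StdForm.antidiagonal 3).over E)) * ((v : (quasiSplit F E c 3).Adelic) * g)) ∂ν) * ((borelHeight g : ℝ) : ℂ) ^ (z' - 2)) (((t : borelAdelic F E c 3) : (quasiSplit F E c 3).Adelic) * (k : (quasiSplit F E c 3).Adelic))) ∂μK = Ξ₄ (diagUnit (t : borelAdelic F E c 3).2 0)) →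
        ∫ x, (quasiSplit F E c 3).quotFun (truncation ν 𝓕 T (eisensteinSeriesU (flatSectionU φ z))) x * conj ((quasiSplit F E c 3).quotFun (truncation ν 𝓕 T (eisensteinSeriesU (flatSectionU φ' z'))) x) ∂μ =
          (cμ : ℂ) * ((K : ℂ) *
            ((((T : ℝ) : ℂ) ^ (z + conj z' - 2) / (z + conj z' - 2)) * (∫ x in {x : (AdeleRing (𝓞 E) E)ˣ | (IdeleClassGroup.ideleNorm E x : ℝ) ≤ 1} ∩ 𝓕I, ((IdeleClassGroup.ideleNorm E x : ℝ) : ℂ) * Ξ₁ x ∂νI)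
              + (((T : ℝ) : ℂ) ^ (z - conj z') / (z - conj z')) * (∫ x in {x : (AdeleRing (𝓞 E) E)ˣ | (IdeleClassGroup.ideleNorm E x : ℝ) ≤ 1} ∩ 𝓕I, ((IdeleClassGroup.ideleNorm E x : ℝ) : ℂ) * Ξ₂ x ∂νI)
              - (((T : ℝ) : ℂ) ^ (-(z - conj z')) / (z - conj z')) * (∫ x in {x : (AdeleRing (𝓞 E) E)ˣ | (IdeleClassGroup.ideleNorm E x : ℝ) ≤ 1} ∩ 𝓕I, ((IdeleClassGroup.ideleNorm E x : ℝ) : ℂ) * Ξ₃ x ∂νI)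
              - (((T : ℝ) : ℂ) ^ (-(z + conj z' - 2)) / (z + conj z' - 2)) * (∫ x in {x : (AdeleRing (𝓞 E) E)ˣ | (IdeleClassGroup.ideleNorm E x : ℝ) ≤ 1} ∩ 𝓕I, ((IdeleClassGroup.ideleNorm E x : ℝ) : ℂ) * Ξ₄ x ∂νI))) := by
  obtain ⟨cμ, K, hcμ, hK, h4⟩ := maassSelberg_flatSectionU_three_ct h2 hc hc1 μ νG μK νI hBK h𝓕I ν h𝓕N h𝓕1
  refine ⟨cμ, K, hcμ, hK, ?_⟩
  intro β hβ T hT φ φ' hφm hφN hφB Cφ hφC hφ'm hφ'N hφ'B Cφ' hφ'C z z' hz' hzz' Cφt hφtC Cφt' hφt'C hfinz hfinz' hsum hΛm hΛG M₁ hΛbdd hint' hψL1 hi₅ habs habs'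
    Ξ₁ Ξ₂ Ξ₃ Ξ₄ hΞ₁m CΞ₁ hΞ₁C hΞ₁K hΞ₁M hΞ₁ hΞ₂m CΞ₂ hΞ₂C hΞ₂K hΞ₂M hΞ₂ hΞ₃m CΞ₃ hΞ₃C hΞ₃K hΞ₃M hΞ₃ hΞ₄m CΞ₄ hΞ₄C hΞ₄K hΞ₄M hΞ₄
  exact h4 hβ hT hφm hφN hφB hφC hφ'm hφ'N hφ'B hφ'C
    (measurable_intertwinedCoeff ν hφm z (z - 2)) (intertwinedCoeff_unipotent_mul hc ν φ z (z - 2)) (intertwinedCoeff_arithmeticBorel_mul hc hc1 ν hφm hφB z (z - 2)) hφtC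
    (measurable_intertwinedCoeff ν hφ'm z' (z' - 2)) (intertwinedCoeff_unipotent_mul hc ν φ' z' (z' - 2)) (intertwinedCoeff_arithmeticBorel_mul hc hc1 ν hφ'm hφ'B z' (z' - 2)) hφt'C
    hz' hzz' (fun g => (flatSectionU_intertwinedCoeff ν φ z g).symm) (fun g => (flatSectionU_intertwinedCoeff ν φ' z' g).symm) hfinz hfinz' hsum hΛm hΛG hΛbdd hint' hψL1 hi₅ habs habs'
    hΞ₁m hΞ₁C hΞ₁K hΞ₁M hΞ₁ hΞ₂m hΞ₂C hΞ₂K hΞ₂M hΞ₂ hΞ₃m hΞ₃C hΞ₃K hΞ₃M hΞ₃ hΞ₄m hΞ₄C hΞ₄K hΞ₄M hΞ₄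

end Intertwined

end Summit.HodgeConjecture.HodgeConjecture.Cruxes.H413.K2E1MaassSelbergCMThreeIntertwined

end
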